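import Summits.AtomisticToContinuum.BoseEinsteinCondensation.Theorems.BECThomsonPrincipleGaussianDominationCanChordTransport
import Summits.AtomisticToContinuum.BoseEinsteinCondensation.Theorems.BECThomsonPrincipleGaussianDominationCanFreeCase
import HarnessLib

/-!
# Crux `GaussianDominationCan`, line `coupling-monotone-chord` — the kinetic-splitting chord

Crux `GaussianDominationCan` (`stmt-AtomisticToContinuum-9479`, route `BECThomsonPrinciple`), line
`coupling-monotone-chord` (lead re-seat c6).  Helper file (`--supports` the crux item; proves no registered
stub): a one-parameter family of chord cuts interpolating the two landed anchors of the line.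

Splitting the kinetic energy, `E_w(Φ) = λ·E_{λ⁻¹•w}(Φ) + (1 − λ)·T(Φ)` for `λ ∈ (0, 1]`
(`periodicEnergy_kineticSplit`), bounding the first term below by the ground-state energy of the
STRONGER potential `λ⁻¹•w` and running the landed free chord (`stub_freeCase`, sharp constant `1/(4π²)`)
on the second at the rescaled source strength `s/(1 − λ)` gives, for every potential `w` (hard cores
included), every `λ ∈ (0,1)`, `s ≥ 0` and every periodic Bose trial state,

  `λ·E₀(λ⁻¹•w) + s·2N|I(Φ)| ≤ E_w(Φ) + s²L²/(4π²(1 − λ)‖n‖∞²)`      (`kineticSplit_chord`).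

At `λ → 1` this is the variational principle `E₀(w) ≤ E_w(Φ)`, at `λ → 0` the anchor band
(`stub_anchorBand`: the free chord with `E₀` dropped).  Consequences: the crux's chord inequality
`GDIneq w m L n C s Φ` holds as soon as the KINETIC-SPLITTING DEFICIT `E₀(w) − λE₀(λ⁻¹•w)` (non-negative,
`scaled_groundStateEnergy_le`) is at most `(C − 1/(4π²(1−λ)))·s²L²/‖n‖²` (`gdIneq_of_kineticSplit`), and
the deficit is at most `(1 − λ)·T(Ψ) + λη` for ANY `η`-near ground state `Ψ` of `λ⁻¹•w`
(`deficit_le_of_witness`), so the chord at `s` is automatic once some near ground state of a slightly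
stronger potential has kinetic energy `≲ C(1−λ)s²/k²` (`gdIneq_of_kineticWitness`): the automatic band of
the line moves from `s ≳ k̃√E₀(w)` down to `s ≳ k̃√⟨T⟩₀` (ground-state KINETIC energy; a gain for soft
potentials, none near hard cores where `⟨T⟩₀ ≈ E₀`).  No member of the family reaches the germ `s → 0`:
that would force the deficit to vanish, i.e. `τ ↦ E₀(τ•w)` affine on `[1, λ⁻¹]`.

References: E. H. Lieb, R. Seiringer, J. P. Solovej, J. Yngvason, *The Mathematics of the Bose Gas and its
Condensation* (2005), App. A (variational principle on the torus); W. Thirring, *Quantum Mathematical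
Physics* §3.5 (concavity of the ground-state energy in linear parameters).  All statements are [folklore].
-/

noncomputable section

namespace Summit.AtomisticToContinuum.BoseEinsteinCondensation.Cruxes.GaussianDominationCan.CouplingMonotoneChord

open MeasureTheory
open scoped ENNReal NNReal
open Literature.MathematicalPhysics.QuantumManyBody.BoseGas
open Summit.AtomisticToContinuum.BoseEinsteinCondensation.Theorems.GaussianDominationCan.Negative
  (GDIneq sourceIntegral)

variable {N : ℕ} {L : ℝ}

/-- **Kinetic splitting of the energy**: `E_w(Φ) = λ·E_{λ⁻¹•w}(Φ) + (1 − λ)·E_0(Φ)` for `0 < λ ≤ 1`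
(the energy is affine along the coupling ray, `periodicEnergy_scalePot`). [folklore] -/
theorem periodicEnergy_kineticSplit (w : ℝ → ℝ≥0∞) {lam : ℝ} (h0 : 0 < lam) (h1 : lam ≤ 1)
    (Φ : PeriodicTrialState N L) :
    periodicEnergy w Φ =
      ENNReal.ofReal lam * periodicEnergy (scalePot lam⁻¹ w) Φ +
        ENNReal.ofReal (1 - lam) * periodicEnergy 0 Φ := by
  conv_lhs => rw [← scalePot_one w]
  rw [periodicEnergy_scalePot 1 w Φ, periodicEnergy_scalePot lam⁻¹ w Φ, mul_add, ← mul_assoc,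
    ← ENNReal.ofReal_mul h0.le, mul_inv_cancel₀ h0.ne', add_right_comm, ← add_mul,
    ← ENNReal.ofReal_add h0.le (sub_nonneg.mpr h1), add_sub_cancel, ENNReal.ofReal_one, one_mul, one_mul]

/-- **The scaled ground-state energy is a lower bound**: `λ·E₀(λ⁻¹•w) ≤ E₀(w)` for `0 < λ ≤ 1` (the
kinetic-splitting deficit is non-negative; concavity of the ground-state energy in the coupling at the
origin). [folklore] -/
theorem scaled_groundStateEnergy_le (w : ℝ → ℝ≥0∞) {lam : ℝ} (h0 : 0 < lam) (h1 : lam ≤ 1) (N : ℕ)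
    (L : ℝ) :
    ENNReal.ofReal lam * periodicGroundStateEnergy (scalePot lam⁻¹ w) N L ≤
      periodicGroundStateEnergy w N L := by
  refine le_iInf fun Φ => ?_
  calc ENNReal.ofReal lam * periodicGroundStateEnergy (scalePot lam⁻¹ w) N L
      ≤ ENNReal.ofReal lam * periodicEnergy (scalePot lam⁻¹ w) Φ :=
        mul_le_mul' le_rfl (periodicGroundStateEnergy_le _ Φ)
    _ ≤ ENNReal.ofReal lam * periodicEnergy (scalePot lam⁻¹ w) Φ +
          ENNReal.ofReal (1 - lam) * periodicEnergy 0 Φ := le_self_add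
    _ = periodicEnergy w Φ := (periodicEnergy_kineticSplit w h0 h1 Φ).symm

/-- **The kinetic-splitting chord.**  For every potential `w`, `λ ∈ (0,1)`, `s ≥ 0` and every periodic
Bose trial state: `λ·E₀(λ⁻¹•w) + s·2N|I(Φ)| ≤ E_w(Φ) + s²L²/(4π²(1−λ)‖n‖∞²)` — the free chord
(`stub_freeCase`) at source strength `s/(1−λ)` on the kinetic share `(1−λ)T(Φ)`, the variational principle
for `λ⁻¹•w` on the rest. [folklore] -/
theorem kineticSplit_chord :
    ∀ (w : ℝ → ℝ≥0∞) (m : ℕ) (L : ℝ), 0 < L → ∀ n : Fin 3 → ℤ, n ≠ 0 →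
      ∀ lam : ℝ, 0 < lam → lam < 1 → ∀ s : ℝ, 0 ≤ s → ∀ Φ : PeriodicTrialState (m + 1) L,
        ENNReal.ofReal lam * periodicGroundStateEnergy (scalePot lam⁻¹ w) (m + 1) L +
            ENNReal.ofReal (s * (2 * (m + 1) * ‖sourceIntegral m L n Φ.ψ‖)) ≤
          periodicEnergy w Φ +
            ENNReal.ofReal (1 / (4 * Real.pi ^ 2 * (1 - lam)) * s ^ 2 * L ^ 2 /
              ‖(fun j => (n j : ℝ))‖ ^ 2) := by
  intro w m L hL n hn lam h0 h1 s hs Φ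
  have h1' : 0 < 1 - lam := sub_pos.mpr h1
  set J : ℝ := 2 * (m + 1) * ‖sourceIntegral m L n Φ.ψ‖ with hJ
  have hJ0 : 0 ≤ J := by positivity
  -- the free chord at strength `s/(1-λ)`, without `E₀(0) ≥ 0`
  have hfree := stub_freeCase m L hL n hn (s / (1 - lam)) (div_nonneg hs h1'.le) Φ
  unfold GDIneq at hfree
  have hfree' : ENNReal.ofReal (s / (1 - lam) * J) ≤ periodicEnergy 0 Φ +
      ENNReal.ofReal (1 / (4 * Real.pi ^ 2) * (s / (1 - lam)) ^ 2 * L ^ 2 /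
        ‖(fun j => (n j : ℝ))‖ ^ 2) := le_add_self.trans hfree
  -- scale it by `1 - λ`
  have hscaled : ENNReal.ofReal (s * J) ≤ ENNReal.ofReal (1 - lam) * periodicEnergy 0 Φ +
      ENNReal.ofReal (1 / (4 * Real.pi ^ 2 * (1 - lam)) * s ^ 2 * L ^ 2 /
        ‖(fun j => (n j : ℝ))‖ ^ 2) := by
    have h : ENNReal.ofReal (1 - lam) * ENNReal.ofReal (s / (1 - lam) * J) ≤
        ENNReal.ofReal (1 - lam) * (periodicEnergy 0 Φ +
          ENNReal.ofReal (1 / (4 * Real.pi ^ 2) * (s / (1 - lam)) ^ 2 * L ^ 2 /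
            ‖(fun j => (n j : ℝ))‖ ^ 2)) := mul_le_mul' le_rfl hfree'
    rw [mul_add, ← ENNReal.ofReal_mul h1'.le, ← ENNReal.ofReal_mul h1'.le] at h
    have e1 : (1 - lam) * (s / (1 - lam) * J) = s * J := by field_simp
    have e2 : (1 - lam) * (1 / (4 * Real.pi ^ 2) * (s / (1 - lam)) ^ 2 * L ^ 2 /
        ‖(fun j => (n j : ℝ))‖ ^ 2) =
        1 / (4 * Real.pi ^ 2 * (1 - lam)) * s ^ 2 * L ^ 2 / ‖(fun j => (n j : ℝ))‖ ^ 2 := by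
      field_simp
    rwa [e1, e2] at h
  -- the variational principle for `λ⁻¹•w` on the rest, and the splitting identity
  calc ENNReal.ofReal lam * periodicGroundStateEnergy (scalePot lam⁻¹ w) (m + 1) L +
        ENNReal.ofReal (s * J)
      ≤ ENNReal.ofReal lam * periodicEnergy (scalePot lam⁻¹ w) Φ +
          (ENNReal.ofReal (1 - lam) * periodicEnergy 0 Φ +
            ENNReal.ofReal (1 / (4 * Real.pi ^ 2 * (1 - lam)) * s ^ 2 * L ^ 2 /
              ‖(fun j => (n j : ℝ))‖ ^ 2)) :=
        add_le_add (mul_le_mul' le_rfl (periodicGroundStateEnergy_le _ Φ)) hscaled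
    _ = periodicEnergy w Φ +
          ENNReal.ofReal (1 / (4 * Real.pi ^ 2 * (1 - lam)) * s ^ 2 * L ^ 2 /
            ‖(fun j => (n j : ℝ))‖ ^ 2) := by
        rw [← add_assoc, ← periodicEnergy_kineticSplit w h0 h1.le Φ]

/-- **Chord from a deficit bound.**  If the kinetic-splitting deficit is small at the source strength `s`,
`E₀(w) ≤ λE₀(λ⁻¹•w) + (C − 1/(4π²(1−λ)))·s²L²/‖n‖²`, then the crux's chord inequality with constant `C`
holds at `s` for every trial state. [folklore] -/
theorem gdIneq_of_kineticSplit (w : ℝ → ℝ≥0∞) (m : ℕ) {L : ℝ} (hL : 0 < L) {n : Fin 3 → ℤ} (hn : n ≠ 0)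
    {lam : ℝ} (h0 : 0 < lam) (h1 : lam < 1) {C s : ℝ} (hC : 1 / (4 * Real.pi ^ 2 * (1 - lam)) ≤ C)
    (hs : 0 ≤ s)
    (hdef : periodicGroundStateEnergy w (m + 1) L ≤
      ENNReal.ofReal lam * periodicGroundStateEnergy (scalePot lam⁻¹ w) (m + 1) L +
        ENNReal.ofReal ((C - 1 / (4 * Real.pi ^ 2 * (1 - lam))) * s ^ 2 * L ^ 2 /
          ‖(fun j => (n j : ℝ))‖ ^ 2))
    (Φ : PeriodicTrialState (m + 1) L) : GDIneq w m L n C s Φ := by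
  have hsplit := kineticSplit_chord w m L hL n hn lam h0 h1 s hs Φ
  unfold GDIneq
  set nv : ℝ := ‖(fun j => (n j : ℝ))‖ with hnv
  set c₀ : ℝ := 1 / (4 * Real.pi ^ 2 * (1 - lam)) with hc₀
  have h1' : 0 < 1 - lam := sub_pos.mpr h1
  have ha : 0 ≤ c₀ * s ^ 2 * L ^ 2 / nv ^ 2 := by positivity
  have hb : 0 ≤ (C - c₀) * s ^ 2 * L ^ 2 / nv ^ 2 :=
    div_nonneg (mul_nonneg (mul_nonneg (sub_nonneg.mpr hC) (sq_nonneg _)) (sq_nonneg _)) (sq_nonneg _)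
  calc periodicGroundStateEnergy w (m + 1) L +
        ENNReal.ofReal (s * (2 * (m + 1) * ‖sourceIntegral m L n Φ.ψ‖))
      ≤ ENNReal.ofReal lam * periodicGroundStateEnergy (scalePot lam⁻¹ w) (m + 1) L +
          ENNReal.ofReal ((C - c₀) * s ^ 2 * L ^ 2 / nv ^ 2) +
          ENNReal.ofReal (s * (2 * (m + 1) * ‖sourceIntegral m L n Φ.ψ‖)) := add_le_add hdef le_rfl
    _ = ENNReal.ofReal lam * periodicGroundStateEnergy (scalePot lam⁻¹ w) (m + 1) L +
          ENNReal.ofReal (s * (2 * (m + 1) * ‖sourceIntegral m L n Φ.ψ‖)) +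
          ENNReal.ofReal ((C - c₀) * s ^ 2 * L ^ 2 / nv ^ 2) := by ring
    _ ≤ periodicEnergy w Φ + ENNReal.ofReal (c₀ * s ^ 2 * L ^ 2 / nv ^ 2) +
          ENNReal.ofReal ((C - c₀) * s ^ 2 * L ^ 2 / nv ^ 2) := add_le_add hsplit le_rfl
    _ = periodicEnergy w Φ + ENNReal.ofReal (C * s ^ 2 * L ^ 2 / nv ^ 2) := by
        rw [add_assoc, ← ENNReal.ofReal_add ha hb]
        congr 2
        ring

/-- **The deficit through a witness.**  For any trial state `Ψ` within `η` of the ground-state energy of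
the stronger potential `λ⁻¹•w`, the kinetic-splitting deficit is at most `(1−λ)·T(Ψ) + λη`:
`E₀(w) ≤ E_w(Ψ) = λE_{λ⁻¹•w}(Ψ) + (1−λ)T(Ψ) ≤ λE₀(λ⁻¹•w) + λη + (1−λ)T(Ψ)`. [folklore] -/
theorem deficit_le_of_witness (w : ℝ → ℝ≥0∞) {lam : ℝ} (h0 : 0 < lam) (h1 : lam ≤ 1) {η : ℝ≥0∞}
    (Ψ : PeriodicTrialState N L)
    (hΨ : periodicEnergy (scalePot lam⁻¹ w) Ψ ≤ periodicGroundStateEnergy (scalePot lam⁻¹ w) N L + η) :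
    periodicGroundStateEnergy w N L ≤
      ENNReal.ofReal lam * periodicGroundStateEnergy (scalePot lam⁻¹ w) N L +
        (ENNReal.ofReal lam * η + ENNReal.ofReal (1 - lam) * periodicEnergy 0 Ψ) := by
  calc periodicGroundStateEnergy w N L ≤ periodicEnergy w Ψ := periodicGroundStateEnergy_le _ Ψ
    _ = ENNReal.ofReal lam * periodicEnergy (scalePot lam⁻¹ w) Ψ +
          ENNReal.ofReal (1 - lam) * periodicEnergy 0 Ψ := periodicEnergy_kineticSplit w h0 h1 Ψ
    _ ≤ ENNReal.ofReal lam * (periodicGroundStateEnergy (scalePot lam⁻¹ w) N L + η) +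
          ENNReal.ofReal (1 - lam) * periodicEnergy 0 Ψ := add_le_add (mul_le_mul' le_rfl hΨ) le_rfl
    _ = _ := by rw [mul_add, add_assoc]

/-- **Chord from a kinetic witness.**  If some `η`-near ground state `Ψ` of the stronger potential
`λ⁻¹•w` has kinetic energy `T(Ψ)` with `λη + (1−λ)T(Ψ) ≤ (C − 1/(4π²(1−λ)))·s²L²/‖n‖²`, the crux's chord
inequality with constant `C` holds at `s` for every trial state: the automatic band of the line sits at
`s ≳ k̃·√(ground-state kinetic energy)` rather than `s ≳ k̃·√E₀`. [folklore] -/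
theorem gdIneq_of_kineticWitness (w : ℝ → ℝ≥0∞) (m : ℕ) {L : ℝ} (hL : 0 < L) {n : Fin 3 → ℤ}
    (hn : n ≠ 0) {lam : ℝ} (h0 : 0 < lam) (h1 : lam < 1) {C s : ℝ}
    (hC : 1 / (4 * Real.pi ^ 2 * (1 - lam)) ≤ C) (hs : 0 ≤ s) {η : ℝ≥0∞}
    (Ψ : PeriodicTrialState (m + 1) L)
    (hΨ : periodicEnergy (scalePot lam⁻¹ w) Ψ ≤
      periodicGroundStateEnergy (scalePot lam⁻¹ w) (m + 1) L + η)
    (hT : ENNReal.ofReal lam * η + ENNReal.ofReal (1 - lam) * periodicEnergy 0 Ψ ≤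
      ENNReal.ofReal ((C - 1 / (4 * Real.pi ^ 2 * (1 - lam))) * s ^ 2 * L ^ 2 /
        ‖(fun j => (n j : ℝ))‖ ^ 2))
    (Φ : PeriodicTrialState (m + 1) L) : GDIneq w m L n C s Φ :=
  gdIneq_of_kineticSplit w m hL hn h0 h1 hC hs
    ((deficit_le_of_witness w h0 h1.le Ψ hΨ).trans (add_le_add le_rfl hT)) Φ

end Summit.AtomisticToContinuum.BoseEinsteinCondensation.Cruxes.GaussianDominationCan.CouplingMonotoneChord

end
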